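import Summits.AtomisticToContinuum.HydrodynamicLimit.Cruxes.ConeLocalisation.Disproof

/-!
# Sketch — crux-ideate round 2, ideator 4, crux `ConeLocalisation` (stmt-AtomisticToContinuum-12504)

Typed first lemmas of the idea card `free-fall-frame` (defs only, no proofs claimed):

* `accel` — the Lagrangian acceleration field `G = ∇p/ρ` of a hard-sphere Euler solution (`Dₜu = -G`).
* `AccelGradientBound` — FIRST LEMMA (pure PDE, a priori): if the level-`M` guards of `S` hold on
  `[0, t]` then `|∇G(0, ·)| ≤ K(M) (1 + 1/t)`: the velocity-gradient guard `|∂u| ≤ M` integrates the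
  matrix Riccati equation `Dₜ(∇u) = -(∇u)² - ∇G` along trajectories.
* `RelativeSlopeBound` — corollary: `|∇ρ(0,x)| ≤ K(M)(1 + 1/t) ρ(0,x)` (no density floor needed, none
  produced: the bound degenerates exactly like `1/t`).
* `ConeBaseDichotomy` — the consequence the line uses: at every point the time-0 datum is, on the cone
  base `B(x₀, c t)`, either RELATIVELY near-constant or RELATIVELY near-log-linear (near-barometric:
  constant `∇ log ρ`, constant `θ`, constant `u` to relative accuracy `δ`), with thresholds chosen after
  `δ` and `c`.
-/

noncomputable section

open Literature.MathematicalPhysics.KineticTheory Literature.Analysis.FluidPDE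
open Literature.Analysis.FunctionSpaces MeasureTheory Filter Set Topology
open Summit.AtomisticToContinuum.HydrodynamicLimit.Cruxes.ConeLocalisation.Disproof (SizeGuards)

namespace Summit.AtomisticToContinuum.HydrodynamicLimit.Cruxes.ConeLocalisation.FreeFallFrame

/-- The Lagrangian acceleration field of a hard-sphere Euler solution, `G = ∇p/ρ` with
`p = hsPressure σ ρ θ` (so that the momentum equation reads `∂ₜu + u·∇u = -G`), component `i`
at time `s` and point `x`. -/
def accel (σ : ℝ) (ρ θ : ℝ → T3 → ℝ) (s : ℝ) (x : T3) (i : Fin 3) : ℝ :=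
  Torus.partialDeriv i (fun y => hsPressure σ (ρ s y) (θ s y)) x / ρ s x

/-- FIRST LEMMA (a priori bound on the acceleration GRADIENT; pure PDE over the tree's
`IsHardSphereEulerSolution`). For every level `M ≥ 1` there are `K, τ, σ₁ > 0` such that for every
reduced diameter `σ < σ₁`, every classical hard-sphere Euler solution on `[0, T)` and every
`0 < t ≤ τ`, `t < T`: if the level-`M` size guards of `S` (`SizeGuards`, Disproof §2 — `ρ ≤ M`,
`θ ∈ [M⁻¹, M]`, `‖u‖ ≤ M`, all `∂^{≤3}` of `(ρ,u,θ)` bounded by `M`) hold on `[0, t] × 𝕋³`, then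
`|∂ⱼ Gᵢ(0, x)| ≤ K (1 + t⁻¹)` for all `x, i, j`. Heuristic constants: `K ≍ 4M + C M⁴ τ`,
`τ ≍ 1/(C M)`, `σ₁³ ≍ 1/(C M³)` (virial corrections). -/
def AccelGradientBound : Prop :=
  ∀ M : ℝ, 1 ≤ M → ∃ K : ℝ, 0 < K ∧ ∃ τ : ℝ, 0 < τ ∧ ∃ σ₁ : ℝ, 0 < σ₁ ∧
    ∀ σ : ℝ, 0 < σ → σ < σ₁ → ∀ (T : ℝ) (ρ θ : ℝ → T3 → ℝ) (u : ℝ → T3 → V3),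
      IsHardSphereEulerSolution σ T ρ u θ →
      ∀ t : ℝ, 0 < t → t < T → t ≤ τ →
        (∀ s ∈ Set.Icc 0 t, ∀ x, SizeGuards M ρ θ u s x) →
        ∀ (x : T3) (i j : Fin 3),
          |Torus.partialDeriv j (fun y => accel σ ρ θ 0 y i) x| ≤ K * (1 + t⁻¹)

/-- COROLLARY (a priori RELATIVE SLOPE bound, floor-free): under the same hypotheses
`|∂ᵢρ(0, x)| ≤ K (1 + t⁻¹) ρ(0, x)` — from `|G(0,x)| ≤ K'(1 + t⁻¹)` (velocity guard integrates
`Dₜu = -G`) and `θ ∇log ρ = (G - ∇θ·(1+O(η)))/(Z + ηZ')`. -/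
def RelativeSlopeBound : Prop :=
  ∀ M : ℝ, 1 ≤ M → ∃ K : ℝ, 0 < K ∧ ∃ τ : ℝ, 0 < τ ∧ ∃ σ₁ : ℝ, 0 < σ₁ ∧
    ∀ σ : ℝ, 0 < σ → σ < σ₁ → ∀ (T : ℝ) (ρ θ : ℝ → T3 → ℝ) (u : ℝ → T3 → V3),
      IsHardSphereEulerSolution σ T ρ u θ →
      ∀ t : ℝ, 0 < t → t < T → t ≤ τ →
        (∀ s ∈ Set.Icc 0 t, ∀ x, SizeGuards M ρ θ u s x) →
        ∀ (x : T3) (i : Fin 3), |Torus.partialDeriv i (ρ 0) x| ≤ K * (1 + t⁻¹) * ρ 0 x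

/-- CONE-BASE DICHOTOMY (the form the line consumes; thresholds `Kg` (gentle) chosen AFTER the
tolerance `δ` and the cone speed `c`). Under the level-`M` guards on `[0, t]`, every point `x₀` is,
on the cone base `B(x₀, c t)` at time `0`, EITHER relatively near-constant (`|ρ/ρ(x₀) - 1|`,
`|θ/θ(x₀) - 1|`, `‖u - u(x₀)‖/√θ(x₀)` all `≤ δ`) OR relatively near-log-linear = near-barometric in
the free-fall frame of `x₀` (log-density slope within relative `δ` of its value at `x₀`, which is
`≥ Kg`; temperature and velocity relatively `δ`-constant). -/
def ConeBaseDichotomy : Prop :=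
  ∀ M : ℝ, 1 ≤ M → ∀ δ : ℝ, 0 < δ → ∀ c : ℝ, 0 < c →
    ∃ Kg : ℝ, 0 < Kg ∧ ∃ τ : ℝ, 0 < τ ∧ ∃ σ₁ : ℝ, 0 < σ₁ ∧
    ∀ σ : ℝ, 0 < σ → σ < σ₁ → ∀ (T : ℝ) (ρ θ : ℝ → T3 → ℝ) (u : ℝ → T3 → V3),
      IsHardSphereEulerSolution σ T ρ u θ →
      ∀ t : ℝ, 0 < t → t < T → t ≤ τ →
        (∀ s ∈ Set.Icc 0 t, ∀ x, SizeGuards M ρ θ u s x) →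
        ∀ x₀ : T3,
          (∀ x, Torus.euclidDist x x₀ ≤ c * t →
              |ρ 0 x / ρ 0 x₀ - 1| ≤ δ ∧ |θ 0 x / θ 0 x₀ - 1| ≤ δ ∧
                ‖u 0 x - u 0 x₀‖ ≤ δ * Real.sqrt (θ 0 x₀)) ∨
          ((∃ i : Fin 3, Kg * ρ 0 x₀ ≤ |Torus.partialDeriv i (ρ 0) x₀|) ∧
            ∀ x, Torus.euclidDist x x₀ ≤ c * t →
              (∀ i : Fin 3, |Torus.partialDeriv i (ρ 0) x / ρ 0 x - Torus.partialDeriv i (ρ 0) x₀ / ρ 0 x₀|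
                  ≤ δ * (∑ j : Fin 3, |Torus.partialDeriv j (ρ 0) x₀|) / ρ 0 x₀) ∧
              |θ 0 x / θ 0 x₀ - 1| ≤ δ ∧ ‖u 0 x - u 0 x₀‖ ≤ δ * Real.sqrt (θ 0 x₀))

/-- Sanity: the three statements are `Prop`s over existing declarations (no new objects posited). -/
example : Prop := AccelGradientBound ∧ RelativeSlopeBound ∧ ConeBaseDichotomy

end Summit.AtomisticToContinuum.HydrodynamicLimit.Cruxes.ConeLocalisation.FreeFallFrame

end
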